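import Literature.Geometry.Riemannian.MetricFlowFDistanceTriangle
import Literature.Geometry.Riemannian.MetricFlowSliceGW1
import Literature.Geometry.Riemannian.MetricFlowAverageDistanceMonotone
import Literature.Geometry.Riemannian.MetricFlowHCenters
import Literature.Geometry.Riemannian.MetricFlowVarianceBounds
import Mathlib.Probability.Kernel.Composition.ParallelComp
import HarnessLib

/-!
# Extending `𝔽`-distance estimates to larger time domains — the `W₁`-toolbox (Bamler 2023,
# §7.2, Lemma 7.? (arXiv v1 Lemma 160), displays (7.15)–(7.17))

R. Bamler, *Compactness theory of the space of super Ricci flows*, Invent. Math. 233 (2023), §7.2,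
Lemma (extending `𝔽`-distance estimates to larger time domains; arXiv v1 Lemma 160): *"closeness
of two metric flow pairs within a correspondence over some given set of times [extends] to
closeness within a correspondence over a larger set of times"*. Its proof defines, for a time `t`
with a near-future time `t'` at which an admissible coupling `q_{t'}` of `μ¹_{t'}, μ²_{t'}` is
given, the coupling
`q_t := ∫_{𝒳¹_{t'} × 𝒳²_{t'}} (ν¹_{x¹;t} ⊗ ν²_{x²;t}) dq_{t'}(x¹, x²)` (7.15)
of `μ¹_t, μ²_t`, and uses the two estimates (for `s ≤ t ≤ t'`, `s ≤ s' ≤ t'`, `y' ∈ 𝒳_{t'}`)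
`∫_{𝒳_t} d_{W₁}^{𝒳_s}(ν_{y;s}, ν_{y';s}) dν_{y';t}(y) ≤ ∫_{𝒳_t} d_{W₁}^{𝒳_t}(δ_y, ν_{y';t}) dν_{y';t}(y)
  ≤ √Var(ν_{y';t}) ≤ √(H(t' − t))` (7.16)
(Prop. 3.24 (b), then the definition of `H`-concentration), and, in any comparison space `Z_s`
receiving isometric embeddings `φ_s`, `φ_{s'}` of `𝒳_s`, `𝒳_{s'}`,
`∫_{𝒳_{t'}} d_{W₁}^{Z_s}((φ_s)_* ν_{y';s}, (φ_{s'})_* ν_{y';s'}) dμ_{t'}(y')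
  ≤ ∫_{𝒳_{s'}} ∫_{𝒳_s} d^Z_s(φ_s(x), φ_{s'}(x')) dν_{x';s}(x) dμ_{s'}(x')` (7.17)
(the coupling `q* := ∫ (ν_{x';s} ⊗ δ_{x'}) dν_{y';s'}(x')` of `ν_{y';s}, ν_{y';s'}`, then the
conjugate heat flow property `μ_{s'} = ∫ ν_{y';s'} dμ_{t'}(y')`).

This auxiliary file proves these three ingredients in the tree's vocabulary (`MetricFlow`,
`condKernel`, `IsConjugateHeatFlow`, `wassersteinW1`, `IsCoupling`, `MetricFlowPair`):

* `MetricFlow.IsConjugateHeatFlow.wassersteinW1_map_le_lintegral_lintegral` — the coupling step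
  `d_{W₁}^Z((φ_s)_* μ_s, (φ_t)_* μ_t) ≤ ∫∫ d_Z(φ_s x, φ_t y) dν_{y;s}(x) dμ_t(y)` for a conjugate
  heat flow (the coupling `∫ ν_{y;s} ⊗ δ_y dμ_t(y)` of §4.2, `sliceCoupling`);
* `MetricFlow.IsHConcentrated.lintegral_wassersteinW1_condKernel_le` — **(7.16)**;
* `MetricFlow.wassersteinW1_map_condKernel_le`, `MetricFlow.measurable_lintegral_edist_condKernel`,
  `MetricFlow.measurable_condKernelCost`,
  `MetricFlow.IsConjugateHeatFlow.lintegral_lintegral_condKernel_eq`,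
  `MetricFlow.IsConjugateHeatFlow.lintegral_wassersteinW1_map_condKernel_le` — **(7.17)**
  (pointwise bound, measurability of the cost `y' ↦ ∫∫ d_Z dν_{x';s} dν_{y';s'}`, and the
  integrated form);
* `MetricFlowPair.extCoupling`, `MetricFlowPair.isCoupling_extCoupling` — **the coupling (7.15)**
  (`(ν¹_{·;t} ∥ₖ ν²_{·;t}) ∘ₘ q_{t'}` with Mathlib's parallel product of Markov kernels) **is a
  coupling of `μ¹_t, μ²_t`**.

Everything is proved; the only definition is `extCoupling`; no named facts.

## References

* R. H. Bamler, *Compactness theory of the space of super Ricci flows*, Invent. Math. 233 (2023),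
  1121–1277 (arXiv:2008.09298), §7.2, Lemma 7.? (arXiv v1 Lemma 160), proof, (7.15)–(7.17);
  §3.2, Prop. 3.24 (b); §4.2, Proposition (d). [Bamler2023]
-/

noncomputable section

open Set MeasureTheory ProbabilityTheory Filter TopologicalSpace Function
open scoped Topology ENNReal NNReal ProbabilityTheory

namespace Literature.Geometry.Riemannian

universe u

namespace MetricFlow

variable {I : Set ℝ} {𝒳 : MetricFlow.{u} I}

/-! ### The coupling step in an arbitrary comparison space -/

/-- **`d_{W₁}^Z((φ_s)_* μ_s, (φ_t)_* μ_t) ≤ ∫_{𝒳_t}∫_{𝒳_s} d_Z(φ_s x, φ_t y) dν_{y;s}(x) dμ_t(y)`** for a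
conjugate heat flow `(μ_t)`, `s ≤ t` in `I'`, and continuous maps `φ_s : 𝒳_s → Z`, `φ_t : 𝒳_t → Z`
into a metric space with its Borel σ-algebra: push the coupling `q = ∫ (ν_{y;s} ⊗ δ_y) dμ_t(y)` of
`μ_s, μ_t` (Bamler 2023, §4.2, Proposition (d), `sliceCoupling`) forward by `φ_s × φ_t`.
[cite: Bamler2023, §4.2, Proposition (closeness of nearby time-slices), (d); §7.2, proof of Lemma 7.? (arXiv v1 Lemma 160)] -/
theorem IsConjugateHeatFlow.wassersteinW1_map_le_lintegral_lintegral {I' : Set ℝ}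
    {μ : ∀ t : I, Measure (𝒳.Slice t)} (hμ : 𝒳.IsConjugateHeatFlow I' μ) {s t : I}
    (hs : (s : ℝ) ∈ I') (ht : (t : ℝ) ∈ I') (hst : (s : ℝ) ≤ t) {Z : Type*} [MetricSpace Z]
    [MeasurableSpace Z] [BorelSpace Z] {φs : 𝒳.Slice s → Z} {φt : 𝒳.Slice t → Z}
    (hφs : Continuous φs) (hφt : Continuous φt) :
    wassersteinW1 ((μ s).map φs) ((μ t).map φt) ≤
      ∫⁻ y, ∫⁻ x, edist (φs x) (φt y) ∂(𝒳.condKernel y s) ∂(μ t) := by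
  haveI := hμ.1 t ht
  haveI : SecondCountableTopology (𝒳.Slice s) := UniformSpace.secondCountable_of_separable _
  haveI : SecondCountableTopology (𝒳.Slice t) := UniformSpace.secondCountable_of_separable _
  obtain ⟨hqP, hq1, hq2⟩ := hμ.isCoupling_sliceCoupling hs ht hst
  haveI := hqP
  have hΦ : Measurable (Prod.map φs φt) :=
    (hφs.measurable.comp measurable_fst).prodMk (hφt.measurable.comp measurable_snd)
  have hc : IsCoupling ((μ s).map φs) ((μ t).map φt)
      ((hμ.sliceCoupling hst).map (Prod.map φs φt)) := by
    refine ⟨Measure.isProbabilityMeasure_map hΦ.aemeasurable, ?_, ?_⟩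
    · rw [Measure.fst, Measure.map_map measurable_fst hΦ, ← hq1, Measure.fst,
        Measure.map_map hφs.measurable measurable_fst]
      rfl
    · rw [Measure.snd, Measure.map_map measurable_snd hΦ, ← hq2, Measure.snd,
        Measure.map_map hφt.measurable measurable_snd]
      rfl
  have hF : Measurable fun p : 𝒳.Slice s × 𝒳.Slice t ↦ edist (φs p.1) (φt p.2) :=
    ((hφs.comp continuous_fst).edist (hφt.comp continuous_snd)).measurable
  calc wassersteinW1 ((μ s).map φs) ((μ t).map φt)
      ≤ ∫⁻ z, edist z.1 z.2 ∂((hμ.sliceCoupling hst).map (Prod.map φs φt)) :=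
        wassersteinW1_le_lintegral hc
    _ ≤ ∫⁻ p, edist (φs p.1) (φt p.2) ∂(hμ.sliceCoupling hst) := lintegral_map_le _ _
    _ = ∫⁻ y, ∫⁻ x, edist (φs x) (φt y) ∂(𝒳.condKernel y s) ∂(μ t) :=
        hμ.lintegral_sliceCoupling ht hst hF

/-- A conjugate heat flow over `I'` is a conjugate heat flow over every smaller set of times.
[cite: Bamler2023, §3.2, Definition (conjugate heat flow)] -/
theorem IsConjugateHeatFlow.anti {I' I'' : Set ℝ} {μ : ∀ t : I, Measure (𝒳.Slice t)}
    (hμ : 𝒳.IsConjugateHeatFlow I' μ) (h : I'' ⊆ I') : 𝒳.IsConjugateHeatFlow I'' μ :=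
  ⟨fun t ht ↦ hμ.1 t (h ht), fun _ _ hs ht hst ↦ hμ.2 (h hs) (h ht) hst⟩

/-! ### (7.16) -/

/-- **Bamler 2023, (7.16)**: in an `H`-concentrated flow, for `s ≤ t ≤ t'` and `y' ∈ 𝒳_{t'}`,
`∫_{𝒳_t} d_{W₁}^{𝒳_s}(ν_{y;s}, ν_{y';s}) dν_{y';t}(y) ≤ √(H(t' − t))`. Printed proof: by Prop. 3.24 (b)
for the conjugate heat flows `(ν_{y;·})`, `(ν_{y';·})` over `I ∩ (−∞, t]`
(`IsConjugateHeatFlow.wassersteinW1_mono_of_variance_ne_top`; their variances at time `s` are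
`≤ H(t − s)`, `≤ H(t' − s)`), the integrand is `≤ d_{W₁}^{𝒳_t}(δ_y, ν_{y';t}) ≤ ∫ d_t(y, ·) dν_{y';t}`,
and `∫∫ d_t dν_{y';t} dν_{y';t} ≤ √Var(ν_{y';t}) ≤ √(H(t' − t))`.
[cite: Bamler2023, §7.2, Lemma 7.? (arXiv v1 Lemma 160), proof, (7.16)] -/
theorem IsHConcentrated.lintegral_wassersteinW1_condKernel_le {H : ℝ} (hH : 𝒳.IsHConcentrated H)
    {s t t' : I} (hst : (s : ℝ) ≤ t) (htt' : (t : ℝ) ≤ t') (y' : 𝒳.Slice t') :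
    ∫⁻ y, wassersteinW1 (𝒳.condKernel y s) (𝒳.condKernel y' s) ∂(𝒳.condKernel y' t) ≤
      (ENNReal.ofReal (H * ((t' : ℝ) - t))) ^ (1 / 2 : ℝ) := by
  haveI : SecondCountableTopology (𝒳.Slice t) := UniformSpace.secondCountable_of_separable _
  haveI := 𝒳.isProbabilityMeasure_condKernel y' htt'
  -- Step 1: Prop. 3.24 (b): `d_{W₁}(ν_{y;s}, ν_{y';s}) ≤ d_{W₁}(δ_y, ν_{y';t})`
  have h1 : ∀ y : 𝒳.Slice t, wassersteinW1 (𝒳.condKernel y s) (𝒳.condKernel y' s) ≤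
      wassersteinW1 (Measure.dirac y) (𝒳.condKernel y' t) := by
    intro y
    have hμ₁ : 𝒳.IsConjugateHeatFlow (I ∩ Iic (t : ℝ)) (fun u ↦ 𝒳.condKernel y u) :=
      𝒳.isConjugateHeatFlow_condKernel y
    have hμ₂ : 𝒳.IsConjugateHeatFlow (I ∩ Iic (t : ℝ)) (fun u ↦ 𝒳.condKernel y' u) :=
      (𝒳.isConjugateHeatFlow_condKernel y').anti
        fun u hu ↦ ⟨hu.1, mem_Iic.2 ((mem_Iic.1 hu.2).trans htt')⟩
    have hV₁ : variance (𝒳.condKernel y s) (𝒳.condKernel y s) ≠ ∞ :=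
      ne_top_of_le_ne_top ENNReal.ofReal_ne_top (hH.variance_condKernel_self_le_ofReal hst y)
    have hV₂ : variance (𝒳.condKernel y' s) (𝒳.condKernel y' s) ≠ ∞ :=
      ne_top_of_le_ne_top ENNReal.ofReal_ne_top
        (hH.variance_condKernel_self_le_ofReal (hst.trans htt') y')
    have h := hμ₁.wassersteinW1_mono_of_variance_ne_top hμ₂ ⟨s.2, mem_Iic.2 hst⟩
      ⟨t.2, mem_Iic.2 le_rfl⟩ hst hV₁ hV₂
    simpa only [𝒳.condKernel_self] using h
  -- Step 2: `d_{W₁}(δ_y, ν) ≤ ∫ d_t(y, ·) dν`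
  have h2 : ∀ y : 𝒳.Slice t, wassersteinW1 (Measure.dirac y) (𝒳.condKernel y' t) ≤
      ∫⁻ z, edist y z ∂(𝒳.condKernel y' t) := fun y ↦ by
    have h := wassersteinW1_le_lintegral_prod (Measure.dirac y) (𝒳.condKernel y' t)
    rwa [lintegral_dirac] at h
  calc ∫⁻ y, wassersteinW1 (𝒳.condKernel y s) (𝒳.condKernel y' s) ∂(𝒳.condKernel y' t)
      ≤ ∫⁻ y, ∫⁻ z, edist y z ∂(𝒳.condKernel y' t) ∂(𝒳.condKernel y' t) :=
        lintegral_mono fun y ↦ (h1 y).trans (h2 y)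
    _ ≤ (variance (𝒳.condKernel y' t) (𝒳.condKernel y' t)) ^ (1 / 2 : ℝ) :=
        lintegral_lintegral_edist_le_sqrt_variance _ _
    _ ≤ _ := ENNReal.rpow_le_rpow (hH.variance_condKernel_self_le_ofReal htt' y') (by norm_num)

/-! ### (7.17) -/

/-- **The pointwise step of (7.17)**: for `s ≤ s' ≤ t'`, `y' ∈ 𝒳_{t'}` and continuous maps
`φ : 𝒳_s → Z`, `ψ : 𝒳_{s'} → Z`,
`d_{W₁}^Z((φ)_* ν_{y';s}, (ψ)_* ν_{y';s'}) ≤ ∫_{𝒳_{s'}}∫_{𝒳_s} d_Z(φ x, ψ x') dν_{x';s}(x) dν_{y';s'}(x')` —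
*"since `q* := ∫ (ν_{x';s} ⊗ δ_{x'}) dν_{y';s'}(x')` is a coupling between `ν_{y';s}, ν_{y';s'}`"*
(the conjugate heat flow `(ν_{y';·})` over `I ∩ (−∞, t']`).
[cite: Bamler2023, §7.2, Lemma 7.? (arXiv v1 Lemma 160), proof, display before (7.17)] -/
theorem wassersteinW1_map_condKernel_le {s s' t' : I} (hss' : (s : ℝ) ≤ s') (hs't' : (s' : ℝ) ≤ t')
    (y' : 𝒳.Slice t') {Z : Type*} [MetricSpace Z] [MeasurableSpace Z] [BorelSpace Z]
    {φ : 𝒳.Slice s → Z} {ψ : 𝒳.Slice s' → Z} (hφ : Continuous φ) (hψ : Continuous ψ) :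
    wassersteinW1 ((𝒳.condKernel y' s).map φ) ((𝒳.condKernel y' s').map ψ) ≤
      ∫⁻ x', ∫⁻ x, edist (φ x) (ψ x') ∂(𝒳.condKernel x' s) ∂(𝒳.condKernel y' s') :=
  (𝒳.isConjugateHeatFlow_condKernel y').wassersteinW1_map_le_lintegral_lintegral
    ⟨s.2, mem_Iic.2 (hss'.trans hs't')⟩ ⟨s'.2, mem_Iic.2 hs't'⟩ hss' hφ hψ

/-- The inner cost `x' ↦ ∫_{𝒳_s} d_Z(φ x, ψ x') dν_{x';s}(x)` is measurable on `𝒳_{s'}` (`s ≤ s'`;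
the conjugate heat kernels form a Markov kernel, `MetricFlow.kernel`).
[cite: Bamler2023, §7.2, Lemma 7.? (arXiv v1 Lemma 160), proof, (7.17)] -/
theorem measurable_lintegral_edist_condKernel {s s' : I} (hss' : (s : ℝ) ≤ s')
    {Z : Type*} [MetricSpace Z] [MeasurableSpace Z] [BorelSpace Z] {φ : 𝒳.Slice s → Z}
    {ψ : 𝒳.Slice s' → Z} (hφ : Continuous φ) (hψ : Continuous ψ) :
    Measurable fun x' : 𝒳.Slice s' ↦ ∫⁻ x, edist (φ x) (ψ x') ∂(𝒳.condKernel x' s) := by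
  have h := Measurable.lintegral_kernel_prod_right (κ := 𝒳.kernel hss')
    (f := fun (x' : 𝒳.Slice s') (x : 𝒳.Slice s) ↦ edist (φ x) (ψ x'))
    ((hφ.comp continuous_snd).edist (hψ.comp continuous_fst)).measurable
  simpa only [kernel_apply] using h

/-- **The cost `y' ↦ ∫_{𝒳_{s'}}∫_{𝒳_s} d_Z(φ x, ψ x') dν_{x';s}(x) dν_{y';s'}(x')` is measurable on
`𝒳_{t'}`** (`s ≤ s' ≤ t'`; the conjugate heat kernels are Markov kernels, `MetricFlow.kernel`).
[cite: Bamler2023, §7.2, Lemma 7.? (arXiv v1 Lemma 160), proof, (7.17)] -/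
theorem measurable_condKernelCost {s s' t' : I} (hss' : (s : ℝ) ≤ s') (hs't' : (s' : ℝ) ≤ t')
    {Z : Type*} [MetricSpace Z] [MeasurableSpace Z] [BorelSpace Z] {φ : 𝒳.Slice s → Z}
    {ψ : 𝒳.Slice s' → Z} (hφ : Continuous φ) (hψ : Continuous ψ) :
    Measurable fun y' : 𝒳.Slice t' ↦
      ∫⁻ x', ∫⁻ x, edist (φ x) (ψ x') ∂(𝒳.condKernel x' s) ∂(𝒳.condKernel y' s') := by
  have h := Measurable.lintegral_kernel (κ := 𝒳.kernel hs't')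
    (measurable_lintegral_edist_condKernel hss' hφ hψ)
  simpa only [kernel_apply] using h

/-- **The conjugate heat flow property integrated**: `∫_{𝒳_{t'}} ∫_{𝒳_{s'}} g dν_{y';s'} dμ_{t'}(y') =
∫_{𝒳_{s'}} g dμ_{s'}` for measurable `g ≥ 0` and `s' ≤ t'` in `I'` (`μ_{s'} = ∫ ν_{y';s'} dμ_{t'}(y')`).
[cite: Bamler2023, §3.2, Definition (conjugate heat flow)] -/
theorem IsConjugateHeatFlow.lintegral_lintegral_condKernel_eq {I' : Set ℝ}
    {μ : ∀ t : I, Measure (𝒳.Slice t)} (hμ : 𝒳.IsConjugateHeatFlow I' μ) {s' t' : I}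
    (hs' : (s' : ℝ) ∈ I') (ht' : (t' : ℝ) ∈ I') (hs't' : (s' : ℝ) ≤ t') {g : 𝒳.Slice s' → ℝ≥0∞}
    (hg : Measurable g) :
    ∫⁻ y', ∫⁻ x', g x' ∂(𝒳.condKernel y' s') ∂(μ t') = ∫⁻ x', g x' ∂(μ s') := by
  rw [hμ.eq_bind hs' ht' hs't', Measure.lintegral_bind (𝒳.kernel hs't').measurable.aemeasurable
    hg.aemeasurable]
  rfl

/-- **Bamler 2023, (7.17)**: for a conjugate heat flow `(μ_t)`, times `s ≤ s' ≤ t'` in `I'` and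
continuous `φ : 𝒳_s → Z`, `ψ : 𝒳_{s'} → Z`,
`∫_{𝒳_{t'}} d_{W₁}^Z((φ)_* ν_{y';s}, (ψ)_* ν_{y';s'}) dμ_{t'}(y') ≤
∫_{𝒳_{s'}}∫_{𝒳_s} d_Z(φ x, ψ x') dν_{x';s}(x) dμ_{s'}(x')` — the pointwise step integrated over `μ_{t'}`
and the conjugate heat flow property.
[cite: Bamler2023, §7.2, Lemma 7.? (arXiv v1 Lemma 160), proof, (7.17)] -/
theorem IsConjugateHeatFlow.lintegral_wassersteinW1_map_condKernel_le {I' : Set ℝ}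
    {μ : ∀ t : I, Measure (𝒳.Slice t)} (hμ : 𝒳.IsConjugateHeatFlow I' μ) {s s' t' : I}
    (hs' : (s' : ℝ) ∈ I') (ht' : (t' : ℝ) ∈ I') (hss' : (s : ℝ) ≤ s') (hs't' : (s' : ℝ) ≤ t')
    {Z : Type*} [MetricSpace Z] [MeasurableSpace Z] [BorelSpace Z] {φ : 𝒳.Slice s → Z}
    {ψ : 𝒳.Slice s' → Z} (hφ : Continuous φ) (hψ : Continuous ψ) :
    ∫⁻ y', wassersteinW1 ((𝒳.condKernel y' s).map φ) ((𝒳.condKernel y' s').map ψ) ∂(μ t') ≤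
      ∫⁻ x', ∫⁻ x, edist (φ x) (ψ x') ∂(𝒳.condKernel x' s) ∂(μ s') := by
  rw [← hμ.lintegral_lintegral_condKernel_eq hs' ht' hs't'
    (measurable_lintegral_edist_condKernel hss' hφ hψ)]
  exact lintegral_mono fun y' ↦ wassersteinW1_map_condKernel_le hss' hs't' y' hφ hψ

end MetricFlow

/-! ### The coupling (7.15) -/

namespace MetricFlowPair

open MetricFlow

variable {J₁ J₂ : Set ℝ} (P₁ : MetricFlowPair.{u} J₁) (P₂ : MetricFlowPair.{u} J₂)

/-- **The coupling `q_t := ∫ (ν¹_{x¹;t} ⊗ ν²_{x²;t}) dq_{t'}(x¹, x²)` of Bamler 2023, (7.15)**, for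
`t ≤ t'` and a measure `q_{t'}` on `𝒳¹_{t'} × 𝒳²_{t'}`: the composition of `q_{t'}` with the parallel
product `ν¹_{·;t} ∥ₖ ν²_{·;t}` of the conjugate heat kernels (Markov kernels `MetricFlow.kernel`).
[cite: Bamler2023, §7.2, Lemma 7.? (arXiv v1 Lemma 160), proof, (7.15)] -/
def extCoupling {t t' : ℝ} (ht₁ : t ∈ P₁.I') (ht₂ : t ∈ P₂.I') (ht'₁ : t' ∈ P₁.I')
    (ht'₂ : t' ∈ P₂.I') (htt' : t ≤ t')
    (q : Measure (P₁.flow.Slice ⟨t', ht'₁⟩ × P₂.flow.Slice ⟨t', ht'₂⟩)) :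
    Measure (P₁.flow.Slice ⟨t, ht₁⟩ × P₂.flow.Slice ⟨t, ht₂⟩) :=
  ((P₁.flow.kernel (t₁ := ⟨t, ht₁⟩) (t₂ := ⟨t', ht'₁⟩) htt') ∥ₖ
    (P₂.flow.kernel (t₁ := ⟨t, ht₂⟩) (t₂ := ⟨t', ht'₂⟩) htt')) ∘ₘ q

variable {P₁ P₂}

/-- The kernel of (7.15) evaluates to the product measure `ν¹_{x¹;t} ⊗ ν²_{x²;t}`.
[cite: Bamler2023, §7.2, Lemma 7.? (arXiv v1 Lemma 160), proof, (7.15)] -/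
theorem extCoupling_kernel_apply {t t' : ℝ} (ht₁ : t ∈ P₁.I') (ht₂ : t ∈ P₂.I') (ht'₁ : t' ∈ P₁.I')
    (ht'₂ : t' ∈ P₂.I') (htt' : t ≤ t')
    (p : P₁.flow.Slice ⟨t', ht'₁⟩ × P₂.flow.Slice ⟨t', ht'₂⟩) :
    ((P₁.flow.kernel (t₁ := ⟨t, ht₁⟩) (t₂ := ⟨t', ht'₁⟩) htt') ∥ₖ
      (P₂.flow.kernel (t₁ := ⟨t, ht₂⟩) (t₂ := ⟨t', ht'₂⟩) htt')) p =
      (P₁.flow.condKernel p.1 ⟨t, ht₁⟩).prod (P₂.flow.condKernel p.2 ⟨t, ht₂⟩) := by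
  rw [Kernel.parallelComp_apply]
  rfl

/-- **`∫ F dq_t ≤ ∫_{q_{t'}} ∫_{ν¹_{x¹;t}} ∫_{ν²_{x²;t}} F`** for every `F ≥ 0` (no measurability
needed for the upper bound: `Measure.lintegral_bind_le`, `lintegral_prod_le`).
[cite: Bamler2023, §7.2, Lemma 7.? (arXiv v1 Lemma 160), proof, first step of the last display] -/
theorem lintegral_extCoupling_le {t t' : ℝ} (ht₁ : t ∈ P₁.I') (ht₂ : t ∈ P₂.I') (ht'₁ : t' ∈ P₁.I')
    (ht'₂ : t' ∈ P₂.I') (htt' : t ≤ t')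
    (q : Measure (P₁.flow.Slice ⟨t', ht'₁⟩ × P₂.flow.Slice ⟨t', ht'₂⟩))
    (F : P₁.flow.Slice ⟨t, ht₁⟩ × P₂.flow.Slice ⟨t, ht₂⟩ → ℝ≥0∞) :
    ∫⁻ p, F p ∂(extCoupling P₁ P₂ ht₁ ht₂ ht'₁ ht'₂ htt' q) ≤
      ∫⁻ p', ∫⁻ y₁, ∫⁻ y₂, F (y₁, y₂) ∂(P₂.flow.condKernel p'.2 ⟨t, ht₂⟩)
        ∂(P₁.flow.condKernel p'.1 ⟨t, ht₁⟩) ∂q := by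
  haveI := fun y : P₂.flow.Slice ⟨t', ht'₂⟩ ↦
    P₂.flow.isProbabilityMeasure_condKernel (s := ⟨t, ht₂⟩) y htt'
  refine (Measure.lintegral_bind_le F q _).trans (lintegral_mono fun p' ↦ ?_)
  rw [extCoupling_kernel_apply]
  exact lintegral_prod_le F

/-- **`q_t` is a coupling between `μ¹_t, μ²_t`** (Bamler 2023, proof of Lemma 7.?: *"Then `q_t` is a
coupling between `μ¹_t, μ²_t`"*): its marginals are `∫ ν^i_{x^i;t} dμ^i_{t'}(x^i) = μ^i_t` by the
conjugate heat flow property, since the marginals of `q_{t'}` are `μ^i_{t'}`.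
[cite: Bamler2023, §7.2, Lemma 7.? (arXiv v1 Lemma 160), proof, (7.15)] -/
theorem isCoupling_extCoupling {t t' : ℝ} (ht₁ : t ∈ P₁.I') (ht₂ : t ∈ P₂.I') (ht'₁ : t' ∈ P₁.I')
    (ht'₂ : t' ∈ P₂.I') (htt' : t ≤ t')
    {q : Measure (P₁.flow.Slice ⟨t', ht'₁⟩ × P₂.flow.Slice ⟨t', ht'₂⟩)}
    (hq : IsCoupling (P₁.μ ⟨t', ht'₁⟩) (P₂.μ ⟨t', ht'₂⟩) q) :
    IsCoupling (P₁.μ ⟨t, ht₁⟩) (P₂.μ ⟨t, ht₂⟩) (extCoupling P₁ P₂ ht₁ ht₂ ht'₁ ht'₂ htt' q) := by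
  obtain ⟨hqP, hq1, hq2⟩ := hq
  haveI := hqP
  haveI := fun y : P₁.flow.Slice ⟨t', ht'₁⟩ ↦
    P₁.flow.isProbabilityMeasure_condKernel (s := ⟨t, ht₁⟩) y htt'
  haveI := fun y : P₂.flow.Slice ⟨t', ht'₂⟩ ↦
    P₂.flow.isProbabilityMeasure_condKernel (s := ⟨t, ht₂⟩) y htt'
  set K := (P₁.flow.kernel (t₁ := ⟨t, ht₁⟩) (t₂ := ⟨t', ht'₁⟩) htt') ∥ₖ
    (P₂.flow.kernel (t₁ := ⟨t, ht₂⟩) (t₂ := ⟨t', ht'₂⟩) htt') with hK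
  refine ⟨inferInstanceAs (IsProbabilityMeasure (K ∘ₘ q)), ?_, ?_⟩
  · -- first marginal
    ext S hS
    rw [Measure.fst_apply hS, show extCoupling P₁ P₂ ht₁ ht₂ ht'₁ ht'₂ htt' q = K ∘ₘ q from rfl,
      Measure.bind_apply (measurable_fst hS) K.aemeasurable]
    have hKS : ∀ p, K p (Prod.fst ⁻¹' S) = P₁.flow.condKernel p.1 ⟨t, ht₁⟩ S := fun p ↦ by
      rw [hK, ← Set.prod_univ, Kernel.parallelComp_apply_prod, kernel_apply, kernel_apply,
        measure_univ, mul_one]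
    simp_rw [hKS]
    rw [← lintegral_map (f := fun y ↦ P₁.flow.condKernel y ⟨t, ht₁⟩ S)
      (P₁.flow.measurable_condKernel_apply (t₁ := ⟨t, ht₁⟩) (t₂ := ⟨t', ht'₁⟩) htt' hS)
      measurable_fst, ← Measure.fst, hq1]
    exact (P₁.isConjugateHeatFlow.2 ht₁ ht'₁ htt' S hS).symm
  · -- second marginal
    ext S hS
    rw [Measure.snd_apply hS, show extCoupling P₁ P₂ ht₁ ht₂ ht'₁ ht'₂ htt' q = K ∘ₘ q from rfl,
      Measure.bind_apply (measurable_snd hS) K.aemeasurable]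
    have hKS : ∀ p, K p (Prod.snd ⁻¹' S) = P₂.flow.condKernel p.2 ⟨t, ht₂⟩ S := fun p ↦ by
      rw [hK, ← Set.univ_prod, Kernel.parallelComp_apply_prod, kernel_apply, kernel_apply,
        measure_univ, one_mul]
    simp_rw [hKS]
    rw [← lintegral_map (f := fun y ↦ P₂.flow.condKernel y ⟨t, ht₂⟩ S)
      (P₂.flow.measurable_condKernel_apply (t₁ := ⟨t, ht₂⟩) (t₂ := ⟨t', ht'₂⟩) htt' hS)
      measurable_snd, ← Measure.snd, hq2]
    exact (P₂.isConjugateHeatFlow.2 ht₂ ht'₂ htt' S hS).symm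

end MetricFlowPair

end Literature.Geometry.Riemannian

end
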